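import Literature.NumberTheory.Automorphic.OrbitalMeasureCanonical        -- ★ `IsCanonical`, `compactCore`, `image_compactCore`, `quotientMeasure`
import Literature.NumberTheory.Automorphic.OrbitalEulerProductModel        -- ★ `(l)integral_descConj_map_cosetCongr` (exact transport along `cosetCongr`)
import Literature.MeasureTheory.Group.InvariantQuotientTransport           -- ★ `map_cosetCongr_quotientMeasure`, `subgroupCongrHomeomorph`
import HarnessLib

/-!
# A CANONICAL orbital measure family read at ANY representative: `O(⟦γ⟧, φ) = ∫_{G ⧸ G_γ} φ(x γ x⁻¹) d(ν ∕ t)`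
# for every inversion-invariant Haar measure `t` on `G_γ` with mass one on the compact core

Topic `NumberTheory/Automorphic`; namespace `Literature.NumberTheory.Automorphic`. KERNEL mathematics
only: theorems, no definition, no named fact, no instance, no notation, no `sorry`. Road «D-N6s» of
cell `pub/hodgecm-mathlib` (LEAD F0P3a-plan (g8) WORD T7-24 (E) ∕ T7-25 (4) «D-S1g — canonical family at
any representative»).  The class orbital integral `classOrbitalIntegral m φ c = O_{out c}(φ; m c)` (★
`LocalOrbitalIntegral`) is taken at the CHOSEN representative `out c`, and a canonical family (★
`OrbitalMeasureFamily.IsCanonical P ν m`: at every `P`-class, `m c = ν ∕ t_c` for THE inversion-invariant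
Haar measure `t_c` on `G_{out c}` with mass one on the compact core) pins the measure only there.  Every
consumer (the split-place transfer B5-L (L2) ∕ B5-R (R3), D-S3i, D-N7s-G2) reads the integral at ITS OWN
representative `γ` with ITS OWN normalised Haar measure `t` on `G_γ`; this file proves once that the
value is the same — with NO compactness ∕ openness hypothesis on the compact core:

* §1 `eq_of_apply_compactCore_eq_one` — two Haar measures on a (second countable, locally compact)
  group giving the compact core outer measure one COINCIDE (Haar uniqueness: they are proportional,
  Mathlib `Measure.isMulLeftInvariant_eq_smul`, and the constant is read on the compact core — no
  measurability, compactness or openness of the core is used; compare ★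
  `CanonicalTorusMeasureTransport.map_eq_of_apply_compactCore_eq_one`, which asks for a compact open
  core, and the primed ★ form in `UnitaryGroupOfLocalCovolumeStable`, behind a heavier closure).
* §2 `apply_out_conjClassesMk_of_forall_conj` — a conjugation-invariant `P` passes from `γ` to `out ⟦γ⟧`;
  **`OrbitalMeasureFamily.IsCanonical.map_cosetCongr_conj_eq_quotientMeasure`** — for `m` canonical for
  `(P, ν)`, `P (out ⟦γ⟧)`, a conjugator `q · out ⟦γ⟧ · q⁻¹ = γ`, and ANY inversion-invariant Haar `t` on
  `G_γ` with `t(compactCore G_γ) = 1`: `(cosetCongr (conj q))_* (m ⟦γ⟧) = ν ∕ t` (★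
  `map_cosetCongr_quotientMeasure` along `conj q : G_{out ⟦γ⟧} ≃ₜ* G_γ`; the transported normalising
  measure is Haar of mass one on the compact core, ★ `image_compactCore`, hence IS `t` by §1);
  **`OrbitalMeasureFamily.IsCanonical.lintegral_descConj_eq_of_apply_compactCore_eq_one`** and
  **`OrbitalMeasureFamily.IsCanonical.classOrbitalIntegral_mk_eq_orbitalIntegral`** — the D-S1g heads:
  `∫⁻_{G ⧸ G_{out ⟦γ⟧}} F d(m ⟦γ⟧) = ∫⁻_{G ⧸ G_γ} F d(ν ∕ t)` and
  `classOrbitalIntegral m φ ⟦γ⟧ = orbitalIntegral γ φ (quotientMeasure G_γ t _ ν)` (Banach-valued `φ`)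
  for `m` canonical, `P (out ⟦γ⟧)`, and ANY such `t` (exact transport ★ `(l)integral_descConj_map_cosetCongr`,
  then `F ∘ conj q` is the `q`-translate of the integrand, ★ `descConj_comp_conj_eq_descConj_smul`, and the
  canonical member is invariant); primed forms `…'` take `P γ` for a conjugation-invariant `P`
  (regularity, `G`-regularity are class functions).
See also ★ `Rogawski1990/SmoothTransferSplitPlaceHSide` (F0P3b-p01 (g5)): the same reading TRANSPORTED
along an isomorphism `j : H ≃* M` (this file is its `j = refl` case in a light import closure), and ★
`CompactCoreLevelPoint.IsCanonical.atPoint_eq_quotientMeasure` (the `∃ t′` form at `m.atPoint γ`).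

## References

* [Rogawski1990] J. D. Rogawski, *Automorphic Representations of Unitary Groups in Three Variables*,
  Ann. of Math. Stud. 123 (1990), §4.3 (4.3.1) p. 43 (orbital integrals with compatible measures on
  `G_γ`; independence of the representative), §4.9 p. 54 (`Φ(γ, f) = ∫_{G_γ∖G} f(g⁻¹ γ g) dg`), §1.7
  p. 6 (Haar measures).
* [DeitmarEchterhoff2014] A. Deitmar, S. Echterhoff, *Principles of Harmonic Analysis*, 2nd ed.
  (2014), Thm. 1.5.3 (the invariant quotient measure `dν ∕ dt`; Haar uniqueness).
* [Gelbart1975] S. Gelbart, *Automorphic forms on adele groups*, Ann. of Math. Stud. 83 (1975),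
  (9.13) (orbital integrals at conjugate representatives).
-/

set_option autoImplicit false

noncomputable section

open MeasureTheory Measure Set
open Literature.MeasureTheory.Group
open scoped ENNReal NNReal

namespace Literature.NumberTheory.Automorphic

/-! ### 1. Haar measures normalised on the compact core are unique -/

section HaarUnique

variable {Z : Type*} [Group Z] [TopologicalSpace Z] [IsTopologicalGroup Z] [LocallyCompactSpace Z]
  [SecondCountableTopology Z] [MeasurableSpace Z] [BorelSpace Z]

/-- **Two Haar measures with mass one on the compact core coincide** (they are proportional by Haar
uniqueness, Mathlib `Measure.isMulLeftInvariant_eq_smul`, and the proportionality constant is read on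
the compact core — outer measures suffice, no measurability of the core is used).
[cite: DeitmarEchterhoff2014, Thm. 1.5.3] [cite: Rogawski1990, §1.7 p. 6] -/
theorem eq_of_apply_compactCore_eq_one (t t' : Measure Z) [t.IsHaarMeasure] [t'.IsHaarMeasure]
    (ht : t (compactCore Z) = 1) (ht' : t' (compactCore Z) = 1) : t = t' := by
  have hs := Measure.isMulLeftInvariant_eq_smul t t'
  have hκ : Measure.haarScalarFactor t t' = 1 := by
    have h2 := congrArg (fun m : Measure Z => m (compactCore Z)) hs
    simp only [Measure.smul_apply, ENNReal.smul_def, smul_eq_mul, ht, ht', mul_one] at h2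
    exact ENNReal.coe_eq_one.1 h2.symm
  rw [hs, hκ, one_smul]

end HaarUnique

/-! ### 2. Canonical families read at any representative -/

section AnyRepresentative

variable {G : Type*} [Group G] [TopologicalSpace G] [IsTopologicalGroup G] [LocallyCompactSpace G]
  [SecondCountableTopology G] [T2Space G] [MeasurableSpace G] [BorelSpace G]
  [∀ γ : G, MeasurableSpace (G ⧸ Subgroup.centralizer ({γ} : Set G))]
  [∀ γ : G, BorelSpace (G ⧸ Subgroup.centralizer ({γ} : Set G))]

omit [TopologicalSpace G] [IsTopologicalGroup G] [LocallyCompactSpace G] [SecondCountableTopology G] [T2Space G]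
  [MeasurableSpace G] [BorelSpace G] [∀ γ : G, MeasurableSpace (G ⧸ Subgroup.centralizer ({γ} : Set G))]
  [∀ γ : G, BorelSpace (G ⧸ Subgroup.centralizer ({γ} : Set G))] in
/-- A conjugation-invariant property passes from `γ` to the chosen representative `out ⟦γ⟧` of its class
(`out ⟦γ⟧ = q⁻¹ γ q` for a conjugator `q`). [cite: Gelbart1975, (9.13)] -/
theorem apply_out_conjClassesMk_of_forall_conj {P : G → Prop} (hP : ∀ g x : G, P g → P (x * g * x⁻¹))
    {γ : G} (h : P γ) : P (Quotient.out (ConjClasses.mk γ)) := by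
  obtain ⟨q, hq⟩ : ∃ q : G, q * Quotient.out (ConjClasses.mk γ) * q⁻¹ = γ :=
    isConj_iff.1 (ConjClasses.mk_eq_mk_iff_isConj.1 (Quotient.out_eq (ConjClasses.mk γ)))
  have h1 : q * Quotient.out (ConjClasses.mk γ) = γ * q := mul_inv_eq_iff_eq_mul.mp hq
  have hout : Quotient.out (ConjClasses.mk γ) = q⁻¹ * γ * q⁻¹⁻¹ := by
    rw [inv_inv, mul_assoc, ← h1, inv_mul_cancel_left]
  rw [hout]
  exact hP γ q⁻¹ h

omit [LocallyCompactSpace G] [SecondCountableTopology G] [T2Space G]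
  [∀ γ : G, MeasurableSpace (G ⧸ Subgroup.centralizer ({γ} : Set G))]
  [∀ γ : G, BorelSpace (G ⧸ Subgroup.centralizer ({γ} : Set G))] in
/-- A left and right invariant measure on `G` is invariant under the inner automorphism `conj q`
(`conj q = (· * q⁻¹) ∘ (q * ·)`); private copy of ★ `CompactCoreLevelPoint.map_mulAutConj_eq_self` kept here
for the light import closure. [folklore] -/
private theorem map_mulAutConj_eq_self_aux (ν : Measure G) [ν.IsMulLeftInvariant] [ν.IsMulRightInvariant]
    (q : G) : Measure.map (MulAut.conj q : G ≃* G) ν = ν := by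
  have h : ((MulAut.conj q : G ≃* G) : G → G) = (fun g => g * q⁻¹) ∘ fun g => q * g := by
    funext g; simp [MulAut.conj_apply]
  rw [h, ← Measure.map_map (measurable_mul_const q⁻¹) (measurable_const_mul q), map_mul_left_eq_self,
    map_mul_right_eq_self]

/-- Transport form of §1 (private plumbing): for `e : Z ≃ₜ* Z′` and Haar measures `t`, `t′` with mass one
on the compact cores, `e_* t = t′` (`e_* t` is Haar with `(e_* t)(compactCore Z′) = t(compactCore Z) = 1`,
★ `image_compactCore`; compare ★ `map_eq_of_apply_compactCore_eq_one(')`). [folklore] -/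
private theorem map_eq_of_apply_compactCore_eq_one_aux {Z Z' : Type*} [Group Z] [Group Z'] [TopologicalSpace Z]
    [TopologicalSpace Z'] [IsTopologicalGroup Z] [IsTopologicalGroup Z'] [LocallyCompactSpace Z']
    [SecondCountableTopology Z'] [MeasurableSpace Z] [BorelSpace Z] [MeasurableSpace Z'] [BorelSpace Z']
    (e : Z ≃ₜ* Z') (t : Measure Z) [t.IsHaarMeasure] (t' : Measure Z') [t'.IsHaarMeasure]
    (ht : t (compactCore Z) = 1) (ht' : t' (compactCore Z') = 1) : Measure.map e t = t' := by
  haveI : (Measure.map e t).IsHaarMeasure := MulEquiv.isHaarMeasure_map t e.toMulEquiv e.continuous e.symm.continuous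
  have h1 : Measure.map e t (compactCore Z') = 1 := by
    have hco : (⇑e : Z → Z') = ⇑(e.toHomeomorph.toMeasurableEquiv) := rfl
    have hpre : ⇑e ⁻¹' compactCore Z' = compactCore Z := by
      rw [← image_compactCore e]; exact e.injective.preimage_image _
    rw [hco, MeasurableEquiv.map_apply, ← hco, hpre, ht]
  exact eq_of_apply_compactCore_eq_one _ _ h1 ht'

/-- **The canonical member transported to any representative IS `ν ∕ t`**: for `m` canonical for `(P, ν)`,
`P (out ⟦γ⟧)`, a conjugator `q` with `q · out ⟦γ⟧ · q⁻¹ = γ`, and ANY inversion-invariant Haar measure `t` on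
`G_γ` with `t(compactCore G_γ) = 1`, the push-forward of `m ⟦γ⟧` along `cosetCongr (conj q) : G ⧸ G_{out ⟦γ⟧}
≃ G ⧸ G_γ` is `quotientMeasure G_γ t _ ν` (★ `map_cosetCongr_quotientMeasure` with `conj(q)_* ν = ν`; the
transported normalising measure is Haar with mass one on the compact core, hence equals `t`, §1).
[cite: DeitmarEchterhoff2014, Thm. 1.5.3] [cite: Rogawski1990, §4.3 (4.3.1) p. 43] -/
theorem OrbitalMeasureFamily.IsCanonical.map_cosetCongr_conj_eq_quotientMeasure
    {P : G → Prop} {ν : Measure G} [ν.IsHaarMeasure] [ν.IsMulRightInvariant] {m : OrbitalMeasureFamily G}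
    (hm : m.IsCanonical P ν) (γ : G) (hc : P (Quotient.out (ConjClasses.mk γ)))
    {q : G} (hq : (MulAut.conj q : G ≃* G) (Quotient.out (ConjClasses.mk γ)) = γ)
    (t : Measure (Subgroup.centralizer ({γ} : Set G))) [t.IsHaarMeasure] [t.IsInvInvariant]
    (ht : t (compactCore (Subgroup.centralizer ({γ} : Set G))) = 1) :
    Measure.map (cosetCongr (MulAut.conj q : G ≃* G) _ (Subgroup.centralizer ({γ} : Set G))
        (forall_apply_mem_centralizer_singleton_iff_of_eq (MulAut.conj q : G ≃* G) hq)) (m (ConjClasses.mk γ)) =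
      quotientMeasure (Subgroup.centralizer ({γ} : Set G)) t (isClosed_coe_centralizer_singleton γ) ν := by
  obtain ⟨t₀, ht₀, hti₀, h1₀, hmc⟩ := hm _ hc
  have he : Continuous (MulAut.conj q : G ≃* G) := IsTopologicalGroup.continuous_conj q
  have hes : Continuous (MulAut.conj q : G ≃* G).symm := by
    change Continuous fun h => q⁻¹ * h * q
    exact (continuous_mul_const q).comp (continuous_const_mul q⁻¹)
  haveI hZc : IsClosed ((Subgroup.centralizer ({(Quotient.out (ConjClasses.mk γ) : G)} : Set G) : Subgroup G) : Set G) :=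
    isClosed_coe_centralizer_singleton _
  haveI hZ'c : IsClosed ((Subgroup.centralizer ({γ} : Set G) : Subgroup G) : Set G) :=
    isClosed_coe_centralizer_singleton γ
  haveI : LocallyCompactSpace (Subgroup.centralizer ({(Quotient.out (ConjClasses.mk γ) : G)} : Set G)) :=
    hZc.isClosedEmbedding_subtypeVal.locallyCompactSpace
  haveI : SecondCountableTopology (Subgroup.centralizer ({(Quotient.out (ConjClasses.mk γ) : G)} : Set G)) :=
    TopologicalSpace.Subtype.secondCountableTopology _
  haveI : LocallyCompactSpace (Subgroup.centralizer ({γ} : Set G)) :=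
    hZ'c.isClosedEmbedding_subtypeVal.locallyCompactSpace
  haveI : SecondCountableTopology (Subgroup.centralizer ({γ} : Set G)) :=
    TopologicalSpace.Subtype.secondCountableTopology _
  -- `conj q` restricted to the centralisers, as a homeomorphism and as a `≃ₜ*`
  let eH : Subgroup.centralizer ({(Quotient.out (ConjClasses.mk γ) : G)} : Set G) ≃ₜ Subgroup.centralizer ({γ} : Set G) :=
    subgroupCongrHomeomorph (MulAut.conj q : G ≃* G) _ _
      (forall_apply_mem_centralizer_singleton_iff_of_eq (MulAut.conj q : G ≃* G) hq) he hes
  let eZ : Subgroup.centralizer ({(Quotient.out (ConjClasses.mk γ) : G)} : Set G) ≃ₜ* Subgroup.centralizer ({γ} : Set G) :=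
    { toMulEquiv :=
        { toEquiv := eH.toEquiv
          map_mul' := fun a b => Subtype.ext (map_mul (MulAut.conj q : G ≃* G) (a : G) (b : G)) }
      continuous_toFun := eH.continuous
      continuous_invFun := eH.symm.continuous }
  have heZ : (eZ : _ → Subgroup.centralizer ({γ} : Set G)) = eH := rfl
  have hmap : Measure.map eH t₀ = t := by
    rw [← heZ]
    exact map_eq_of_apply_compactCore_eq_one_aux eZ t₀ t h1₀ ht
  rw [hmc]
  exact map_cosetCongr_quotientMeasure (MulAut.conj q : G ≃* G) he hes _ _ _ t₀ t ν ν hmap.symm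
    (map_mulAutConj_eq_self_aux ν q).symm

/-- **A canonical family read at any representative, `[0, ∞]`-valued integrands**: for `m` canonical for
`(P, ν)` (★ `OrbitalMeasureFamily.IsCanonical`), a class with `P (out ⟦γ⟧)`, and ANY inversion-invariant
Haar measure `t` on the centraliser `G_γ` with `t(compactCore G_γ) = 1`,
`∫⁻_{G ⧸ G_{out ⟦γ⟧}} F(y · out ⟦γ⟧ · y⁻¹) d(m ⟦γ⟧) = ∫⁻_{G ⧸ G_γ} F(x γ x⁻¹) d(ν ∕ t)` for every `F : G → [0, ∞]`
(transport along `cosetCongr (conj q)`, ★ `lintegral_descConj_map_cosetCongr`; `F ∘ conj q` is the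
`q`-translate of the integrand, ★ `descConj_comp_conj_eq_descConj_smul`; the canonical member is invariant).
[cite: Rogawski1990, §4.3 (4.3.1) p. 43; §4.9 p. 54] [cite: DeitmarEchterhoff2014, Thm. 1.5.3] -/
theorem OrbitalMeasureFamily.IsCanonical.lintegral_descConj_eq_of_apply_compactCore_eq_one
    {P : G → Prop} {ν : Measure G} [ν.IsHaarMeasure] [ν.IsMulRightInvariant] {m : OrbitalMeasureFamily G}
    (hm : m.IsCanonical P ν) (γ : G) (hc : P (Quotient.out (ConjClasses.mk γ)))
    (t : Measure (Subgroup.centralizer ({γ} : Set G))) [t.IsHaarMeasure] [t.IsInvInvariant]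
    (ht : t (compactCore (Subgroup.centralizer ({γ} : Set G))) = 1) (F : G → ℝ≥0∞) :
    ∫⁻ y, descConj (Quotient.out (ConjClasses.mk γ))
        (Subgroup.centralizer ({(Quotient.out (ConjClasses.mk γ) : G)} : Set G)) (centralizer_comm _) F y
        ∂(m (ConjClasses.mk γ)) =
      ∫⁻ x, descConj γ (Subgroup.centralizer ({γ} : Set G)) (centralizer_comm γ) F x
        ∂(quotientMeasure (Subgroup.centralizer ({γ} : Set G)) t (isClosed_coe_centralizer_singleton γ) ν) := by
  obtain ⟨q, hq⟩ : ∃ q : G, q * Quotient.out (ConjClasses.mk γ) * q⁻¹ = γ :=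
    isConj_iff.1 (ConjClasses.mk_eq_mk_iff_isConj.1 (Quotient.out_eq (ConjClasses.mk γ)))
  have hφγ : (MulAut.conj q : G ≃* G) (Quotient.out (ConjClasses.mk γ)) = γ := hq
  have he : Continuous (MulAut.conj q : G ≃* G) := IsTopologicalGroup.continuous_conj q
  have hes : Continuous (MulAut.conj q : G ≃* G).symm := by
    change Continuous fun h => q⁻¹ * h * q
    exact (continuous_mul_const q).comp (continuous_const_mul q⁻¹)
  haveI : SMulInvariantMeasure G (G ⧸ Subgroup.centralizer ({(Quotient.out (ConjClasses.mk γ) : G)} : Set G))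
      (m (ConjClasses.mk γ)) := (hm.isAdmissibleOn _ hc).2.1
  rw [← hm.map_cosetCongr_conj_eq_quotientMeasure γ hc hφγ t ht,
    lintegral_descConj_map_cosetCongr (MulAut.conj q : G ≃* G) he hes hφγ _ F]
  simp_rw [descConj_comp_conj_eq_descConj_smul q (Quotient.out (ConjClasses.mk γ)) F]
  exact ((measurePreserving_smul q (m (ConjClasses.mk γ))).lintegral_comp_emb
    (measurableEmbedding_const_smul q) _).symm

/-- **A canonical family read at any representative** (the D-S1g head): for `m` canonical for `(P, ν)`,
`γ` with `P (out ⟦γ⟧)`, ANY inversion-invariant Haar measure `t` on `G_γ` with `t(compactCore G_γ) = 1`,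
and `φ : G → E` (Banach `E`), `classOrbitalIntegral m φ ⟦γ⟧ = orbitalIntegral γ φ (quotientMeasure G_γ t _ ν)`:
the class orbital integral — defined at the chosen representative `out ⟦γ⟧` against the canonical member
`ν ∕ t_{out ⟦γ⟧}` — equals the orbital integral at `γ` against `ν ∕ t` («the orbital integrals are defined
using compatible measures on `G_γ`» does not depend on the representative).
[cite: Rogawski1990, §4.3 (4.3.1) p. 43; §4.9 p. 54] [cite: DeitmarEchterhoff2014, Thm. 1.5.3] [cite: Gelbart1975, (9.13)] -/
theorem OrbitalMeasureFamily.IsCanonical.classOrbitalIntegral_mk_eq_orbitalIntegral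
    {P : G → Prop} {ν : Measure G} [ν.IsHaarMeasure] [ν.IsMulRightInvariant] {m : OrbitalMeasureFamily G}
    (hm : m.IsCanonical P ν) {γ : G} (hc : P (Quotient.out (ConjClasses.mk γ)))
    (t : Measure (Subgroup.centralizer ({γ} : Set G))) [t.IsHaarMeasure] [t.IsInvInvariant]
    (ht : t (compactCore (Subgroup.centralizer ({γ} : Set G))) = 1)
    {E : Type*} [NormedAddCommGroup E] [NormedSpace ℝ E] (φ : G → E) :
    classOrbitalIntegral m φ (ConjClasses.mk γ) =
      orbitalIntegral γ φ (quotientMeasure (Subgroup.centralizer ({γ} : Set G)) t (isClosed_coe_centralizer_singleton γ) ν) := by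
  obtain ⟨q, hq⟩ : ∃ q : G, q * Quotient.out (ConjClasses.mk γ) * q⁻¹ = γ :=
    isConj_iff.1 (ConjClasses.mk_eq_mk_iff_isConj.1 (Quotient.out_eq (ConjClasses.mk γ)))
  have hφγ : (MulAut.conj q : G ≃* G) (Quotient.out (ConjClasses.mk γ)) = γ := hq
  have he : Continuous (MulAut.conj q : G ≃* G) := IsTopologicalGroup.continuous_conj q
  have hes : Continuous (MulAut.conj q : G ≃* G).symm := by
    change Continuous fun h => q⁻¹ * h * q
    exact (continuous_mul_const q).comp (continuous_const_mul q⁻¹)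
  haveI : SMulInvariantMeasure G (G ⧸ Subgroup.centralizer ({(Quotient.out (ConjClasses.mk γ) : G)} : Set G))
      (m (ConjClasses.mk γ)) := (hm.isAdmissibleOn _ hc).2.1
  rw [classOrbitalIntegral_eq, orbitalIntegral_eq_integral_descConj, orbitalIntegral_eq_integral_descConj,
    ← hm.map_cosetCongr_conj_eq_quotientMeasure γ hc hφγ t ht,
    integral_descConj_map_cosetCongr (MulAut.conj q : G ≃* G) he hes hφγ _ φ]
  simp_rw [descConj_comp_conj_eq_descConj_smul q (Quotient.out (ConjClasses.mk γ)) φ]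
  exact (integral_smul_eq_self _).symm

/-- **Primed form, `[0, ∞]`-valued**: the hypothesis at `γ` for a conjugation-invariant `P` (regularity,
`G`-regularity, … are class functions). [cite: Rogawski1990, §4.3 (4.3.1) p. 43; §4.9 p. 54] -/
theorem OrbitalMeasureFamily.IsCanonical.lintegral_descConj_eq_of_apply_compactCore_eq_one'
    {P : G → Prop} (hP : ∀ g x : G, P g → P (x * g * x⁻¹)) {ν : Measure G} [ν.IsHaarMeasure] [ν.IsMulRightInvariant]
    {m : OrbitalMeasureFamily G} (hm : m.IsCanonical P ν) (γ : G) (hγ : P γ)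
    (t : Measure (Subgroup.centralizer ({γ} : Set G))) [t.IsHaarMeasure] [t.IsInvInvariant]
    (ht : t (compactCore (Subgroup.centralizer ({γ} : Set G))) = 1) (F : G → ℝ≥0∞) :
    ∫⁻ y, descConj (Quotient.out (ConjClasses.mk γ))
        (Subgroup.centralizer ({(Quotient.out (ConjClasses.mk γ) : G)} : Set G)) (centralizer_comm _) F y
        ∂(m (ConjClasses.mk γ)) =
      ∫⁻ x, descConj γ (Subgroup.centralizer ({γ} : Set G)) (centralizer_comm γ) F x
        ∂(quotientMeasure (Subgroup.centralizer ({γ} : Set G)) t (isClosed_coe_centralizer_singleton γ) ν) :=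
  hm.lintegral_descConj_eq_of_apply_compactCore_eq_one γ (apply_out_conjClassesMk_of_forall_conj hP hγ) t ht F

/-- **Primed form, Banach-valued**: `classOrbitalIntegral m φ ⟦γ⟧ = orbitalIntegral γ φ (ν ∕ t)` with the
hypothesis `P γ` for a conjugation-invariant `P`. [cite: Rogawski1990, §4.3 (4.3.1) p. 43; §4.9 p. 54] -/
theorem OrbitalMeasureFamily.IsCanonical.classOrbitalIntegral_mk_eq_orbitalIntegral'
    {P : G → Prop} (hP : ∀ g x : G, P g → P (x * g * x⁻¹)) {ν : Measure G} [ν.IsHaarMeasure] [ν.IsMulRightInvariant]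
    {m : OrbitalMeasureFamily G} (hm : m.IsCanonical P ν) {γ : G} (hγ : P γ)
    (t : Measure (Subgroup.centralizer ({γ} : Set G))) [t.IsHaarMeasure] [t.IsInvInvariant]
    (ht : t (compactCore (Subgroup.centralizer ({γ} : Set G))) = 1)
    {E : Type*} [NormedAddCommGroup E] [NormedSpace ℝ E] (φ : G → E) :
    classOrbitalIntegral m φ (ConjClasses.mk γ) =
      orbitalIntegral γ φ (quotientMeasure (Subgroup.centralizer ({γ} : Set G)) t (isClosed_coe_centralizer_singleton γ) ν) :=
  hm.classOrbitalIntegral_mk_eq_orbitalIntegral (apply_out_conjClassesMk_of_forall_conj hP hγ) t ht φ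

end AnyRepresentative

end Literature.NumberTheory.Automorphic

end
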